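import Literature.Geometry.Kaehler.TransversalPairChart
import Literature.Analysis.Complex.HadamardDivision
import HarnessLib

/-!
# The ideal of a transversal pair on a surface: `f = 0` on `{t₁ = t₂ = 0}` forces `f = t₁ g₁ + t₂ g₂`

For two holomorphic functions `t₁, t₂` on a convex open set `Ω` of a `2`-dimensional complex normed
space with `dt₁ ≠ 0` on `{t₁ = 0}` and `(dt₁, dt₂)` onto `ℂ²` on `Z = {t₁ = t₂ = 0}`, every `f`
holomorphic on `Ω` and vanishing on `Z` writes `f = t₁ g₁ + t₂ g₂` with `g₁, g₂` holomorphic on `Ω`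
— exactness of the Koszul-type sequence `𝒪² → 𝒪 → 𝒪_Z → 0` of the two hyperplane sections on
sections over `Ω` (J.-P. Serre, *GAGA* n° 16 Lemme 8: the bottom level of the induction, where the
cokernel sheaf of the second section is the reduced skyscraper at `Z`).

* `exists_nhds_eq_add_mul_of_finrank_eq_two` — LOCALLY at `z ∈ Z`: Hadamard's lemma
  (`Literature.Analysis.Complex.SCV.exists_eq_sum_smul_of_apply_eq_zero`) for `f`, `t₁`, `t₂` at `z` in linear
  coordinates `ℓ₁, ℓ₂`, `t_k = Σ ℓᵢ(· - z) h_{ki}`, and Cramer's rule for the `2 × 2` matrix `(h_{ki})`,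
  invertible near `z` because `(h_{ki}(z))` carries `(ℓ₁, ℓ₂)` to `(dt₁(z), dt₂(z))`;
* `exists_eq_add_mul_of_eqOn_zero_of_finrank_eq_two` — on a CONVEX `Ω`: the local pairs
  (`(f/t₁, 0)` off `{t₁ = 0}`, `(0, f/t₂)` off `{t₂ = 0}`) differ by Koszul boundaries
  `(t₂ c, -t₁ c)` (the regular-pair lemma `SCV.exists_eq_smul_of_mul_eq_mul`, E. M. Chirka §2.8),
  the `c` form a holomorphic `1`-cocycle, solvable on the convex `Ω`
  (`exists_holomorphic_cochain_of_cocycle_of_convex`), and the corrected pairs glue;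
* `exists_mdifferentiableOn_eq_add_mul_chartSet` — the same on a chart set `chartSet 𝓘(ℝ, E) x₀ C`
  (`C` convex open in the chart target) of a complex surface, differential hypotheses in `mfderiv`
  form.

Everything is proved; theorems only.

## References

* J.-P. Serre, *Géométrie algébrique et géométrie analytique* (1956), n° 16 Lemme 8. [SerreGAGA1956]
* E. M. Chirka, *Complex Analytic Sets* (1989), §2.8 and A1.1. [Chirka1989]
* K. Fritzsche, H. Grauert, *From Holomorphic Functions to Complex Manifolds* (2002), Ch. V §1, §3.
  [FritzscheGrauert2002]
-/

noncomputable section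

open scoped Manifold ContDiff Topology
open Set Filter Metric Literature.Analysis.Complex

namespace Literature.Geometry.Kaehler

section Flat

variable {E : Type*} [NormedAddCommGroup E] [NormedSpace ℂ E] [FiniteDimensional ℂ E]

/-- A `2 × 2` linear system with jointly surjective rows has non-zero determinant: if
`Λ x = (a ℓ₁ x + b ℓ₂ x, c ℓ₁ x + d ℓ₂ x)` is onto `ℂ²` then `a d - b c ≠ 0`. [folklore] -/
theorem det_ne_zero_of_surjective {V : Type*} [AddCommGroup V] [Module ℂ V] [TopologicalSpace V]
    {L₁ L₂ ℓ₁ ℓ₂ : V →L[ℂ] ℂ} {a b c d : ℂ} (h₁ : L₁ = a • ℓ₁ + b • ℓ₂) (h₂ : L₂ = c • ℓ₁ + d • ℓ₂)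
    (hs : Function.Surjective (ContinuousLinearMap.pi ![L₁, L₂])) : a * d - b * c ≠ 0 := by
  intro hdet
  -- a non-zero vector `(p, q)` with `p L₁ + q L₂ = 0`
  have key : ∃ p q : ℂ, (p ≠ 0 ∨ q ≠ 0) ∧ ∀ x, p * L₁ x + q * L₂ x = 0 := by
    by_cases hbd : b ≠ 0 ∨ d ≠ 0
    · refine ⟨d, -b, ?_, fun x ↦ ?_⟩
      · rcases hbd with hb | hd
        · exact Or.inr (neg_ne_zero.2 hb)
        · exact Or.inl hd
      · rw [h₁, h₂]
        simp only [FunLike.coe_add, Pi.add_apply, FunLike.coe_smul, Pi.smul_apply, smul_eq_mul]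
        linear_combination (ℓ₁ x) * hdet
    · simp only [not_or, not_ne_iff] at hbd
      obtain ⟨hb, hd⟩ := hbd
      by_cases hac : a ≠ 0 ∨ c ≠ 0
      · refine ⟨c, -a, ?_, fun x ↦ ?_⟩
        · rcases hac with ha | hc
          · exact Or.inr (neg_ne_zero.2 ha)
          · exact Or.inl hc
        · rw [h₁, h₂, hb, hd]
          simp only [FunLike.coe_add, Pi.add_apply, FunLike.coe_smul, Pi.smul_apply, smul_eq_mul]
          ring
      · simp only [not_or, not_ne_iff] at hac
        refine ⟨1, 0, Or.inl one_ne_zero, fun x ↦ ?_⟩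
        rw [h₁, hac.1, hb]
        simp
  obtain ⟨p, q, hpq, hrel⟩ := key
  -- test against the vector with `(L₁, L₂) = (conj p, conj q)`
  obtain ⟨y, hy⟩ := hs ![star p, star q]
  have hy0 : L₁ y = star p := by simpa using congr_fun hy 0
  have hy1 : L₂ y = star q := by simpa using congr_fun hy 1
  have h' := hrel y
  rw [hy0, hy1] at h'
  erw [Complex.mul_conj, Complex.mul_conj] at h'
  have hp : Complex.normSq p = 0 ∧ Complex.normSq q = 0 := by
    have h1 : (Complex.normSq p : ℂ) + Complex.normSq q = 0 := h'
    have h2 : Complex.normSq p + Complex.normSq q = 0 := by exact_mod_cast h1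
    constructor <;> nlinarith [Complex.normSq_nonneg p, Complex.normSq_nonneg q]
  rcases hpq with hp0 | hq0
  · exact hp0 (Complex.normSq_eq_zero.1 hp.1)
  · exact hq0 (Complex.normSq_eq_zero.1 hp.2)

/-- **Local division by a transversal pair on a surface.** Let `dim E = 2`, `t₁, t₂, f` holomorphic
on an open `U ∋ z` with `t₁(z) = t₂(z) = f(z) = 0` and `(dt₁(z), dt₂(z))` onto `ℂ²`. Then on some
open `N ∋ z`, `N ⊆ U`: `f = t₁ g₁ + t₂ g₂` with `g₁, g₂` holomorphic on `N` (Hadamard's lemma at `z`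
for `f, t₁, t₂` and Cramer's rule for the Hadamard matrix of `(t₁, t₂)`, invertible near `z`).
[cite: Chirka1989, A1.1 and §2.8] -/
theorem exists_nhds_eq_add_mul_of_finrank_eq_two (hE : Module.finrank ℂ E = 2) {U : Set E} (hU : IsOpen U)
    {t₁ t₂ f : E → ℂ} (ht₁ : DifferentiableOn ℂ t₁ U) (ht₂ : DifferentiableOn ℂ t₂ U)
    (hf : DifferentiableOn ℂ f U) {z : E} (hz : z ∈ U) (h1z : t₁ z = 0) (h2z : t₂ z = 0) (hfz : f z = 0)
    (hsurj : Function.Surjective (ContinuousLinearMap.pi ![fderiv ℂ t₁ z, fderiv ℂ t₂ z])) :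
    ∃ N : Set E, IsOpen N ∧ z ∈ N ∧ N ⊆ U ∧ ∃ g₁ g₂ : E → ℂ, DifferentiableOn ℂ g₁ N ∧
      DifferentiableOn ℂ g₂ N ∧ ∀ x ∈ N, f x = t₁ x * g₁ x + t₂ x * g₂ x := by
  classical
  -- linear coordinates
  set bs : Module.Basis (Fin 2) ℂ E := Module.finBasisOfFinrankEq ℂ E hE with hbs
  set ℓ : Fin 2 → E →L[ℂ] ℂ := fun i ↦ LinearMap.toContinuousLinearMap (bs.coord i) with hℓ
  have hℓ_apply : ∀ i x, ℓ i x = bs.repr x i := fun i x ↦ rfl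
  have hdual : ∀ i j, ℓ i (bs j) = if i = j then 1 else 0 := fun i j ↦ by
    rw [hℓ_apply, bs.repr_self, Finsupp.single_apply]
    rcases eq_or_ne i j with rfl | hij
    · simp
    · simp [hij, hij.symm]
  have hspan : ∀ x : E, ∑ i, ℓ i x • bs i = x := fun x ↦ by
    simp only [hℓ_apply]; exact bs.sum_repr x
  -- a product domain `P ∋ z` inside `U`
  obtain ⟨r, hr, hrU⟩ := Metric.isOpen_iff.1 hU z hz
  set S : ℝ := ∑ i, ‖bs i‖ with hS
  have hS0 : 0 ≤ S := Finset.sum_nonneg fun i _ ↦ norm_nonneg _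
  set ρ : ℝ := r / (1 + S) with hρ
  have hρ0 : 0 < ρ := div_pos hr (by linarith)
  set D : Fin 2 → Set ℂ := fun _ ↦ ball 0 ρ with hD
  have hDo : ∀ i, IsOpen (D i) := fun _ ↦ isOpen_ball
  have hD0 : ∀ i, (0 : ℂ) ∈ D i := fun _ ↦ mem_ball_self hρ0
  set P : Set E := {x | ∀ i, ℓ i (x - z) ∈ D i} with hP
  have hPo : IsOpen P := by
    have : P = ⋂ i, (fun x ↦ ℓ i (x - z)) ⁻¹' D i := by ext x; simp [hP]
    rw [this]
    exact isOpen_iInter_of_finite fun i ↦ (hDo i).preimage (by fun_prop)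
  have hzP : z ∈ P := fun i ↦ by simp [hD, hρ0]
  have hPU : P ⊆ U := fun x hx ↦ hrU (by
    rw [mem_ball, dist_eq_norm]
    have h1 : ‖x - z‖ ≤ ∑ i, ‖ℓ i (x - z)‖ * ‖bs i‖ := by
      conv_lhs => rw [← hspan (x - z)]
      exact (norm_sum_le _ _).trans (Finset.sum_le_sum fun i _ ↦ norm_smul_le _ _)
    have h2 : ∑ i, ‖ℓ i (x - z)‖ * ‖bs i‖ ≤ ∑ i, ρ * ‖bs i‖ :=
      Finset.sum_le_sum fun i _ ↦ mul_le_mul_of_nonneg_right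
        (le_of_lt (by simpa [hD] using hx i)) (norm_nonneg _)
    have h3 : ∑ i, ρ * ‖bs i‖ = ρ * S := by rw [hS, Finset.mul_sum]
    have h4 : ρ * S < r := by
      rw [hρ, div_mul_eq_mul_div, div_lt_iff₀ (by linarith)]
      nlinarith
    linarith)
  -- Hadamard for `f`, `t₁`, `t₂` at `z`
  obtain ⟨g, hg, hfg⟩ := SCV.exists_eq_sum_smul_of_apply_eq_zero bs ℓ hdual hspan z D hDo hD0
    (hf.mono hPU) hfz
  obtain ⟨h₁, hh₁, hth₁⟩ := SCV.exists_eq_sum_smul_of_apply_eq_zero bs ℓ hdual hspan z D hDo hD0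
    (ht₁.mono hPU) h1z
  obtain ⟨h₂, hh₂, hth₂⟩ := SCV.exists_eq_sum_smul_of_apply_eq_zero bs ℓ hdual hspan z D hDo hD0
    (ht₂.mono hPU) h2z
  -- the differentials at `z`: `dt_k(z) = Σ h_{ki}(z) ℓ_i`
  have hderiv : ∀ {t : E → ℂ} {h : Fin 2 → E → ℂ}, DifferentiableOn ℂ t U →
      (∀ i, DifferentiableOn ℂ (h i) P) → (∀ x ∈ P, t x = ∑ i, ℓ i (x - z) • h i x) →
      fderiv ℂ t z = h 0 z • ℓ 0 + h 1 z • ℓ 1 := by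
    intro t h htd hhd hth
    have hev : t =ᶠ[𝓝 z] fun x ↦ ∑ i, ℓ i (x - z) • h i x := by
      filter_upwards [hPo.mem_nhds hzP] with x hx using hth x hx
    have hterm : ∀ i, HasFDerivAt (fun x ↦ ℓ i (x - z) • h i x) (h i z • ℓ i) z := fun i ↦ by
      have hl : HasFDerivAt (fun x ↦ ℓ i (x - z)) (ℓ i) z := by
        simp only [map_sub]
        exact (ℓ i).hasFDerivAt.sub_const (ℓ i z)
      have hh : HasFDerivAt (h i) (fderiv ℂ (h i) z) z :=
        ((hhd i).differentiableAt (hPo.mem_nhds hzP)).hasFDerivAt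
      refine (hl.smul hh).congr_fderiv ?_
      ext v
      simp [mul_comm]
    have hsum : HasFDerivAt (fun x ↦ ∑ i, ℓ i (x - z) • h i x) (∑ i, h i z • ℓ i) z :=
      HasFDerivAt.fun_sum fun i _ ↦ hterm i
    rw [hev.fderiv_eq, hsum.fderiv, Fin.sum_univ_two]
  have hd₁ := hderiv ht₁ hh₁ hth₁
  have hd₂ := hderiv ht₂ hh₂ hth₂
  -- the Hadamard matrix is invertible at `z`, hence near `z`
  set δ : E → ℂ := fun x ↦ h₁ 0 x * h₂ 1 x - h₁ 1 x * h₂ 0 x with hδ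
  have hδz : δ z ≠ 0 := det_ne_zero_of_surjective hd₁ hd₂ hsurj
  have hδd : DifferentiableOn ℂ δ P := ((hh₁ 0).mul (hh₂ 1)).sub ((hh₁ 1).mul (hh₂ 0))
  set N : Set E := P ∩ δ ⁻¹' {0}ᶜ with hN
  have hNo : IsOpen N := hδd.continuousOn.isOpen_inter_preimage hPo isOpen_compl_singleton
  refine ⟨N, hNo, ⟨hzP, hδz⟩, inter_subset_left.trans hPU,
    fun x ↦ (h₂ 1 x * g 0 x - h₂ 0 x * g 1 x) * (δ x)⁻¹, fun x ↦ (h₁ 0 x * g 1 x - h₁ 1 x * g 0 x) * (δ x)⁻¹,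
    ?_, ?_, fun x hx ↦ ?_⟩
  · exact ((((hh₂ 1).mul (hg 0)).sub ((hh₂ 0).mul (hg 1))).mono inter_subset_left).mul
      ((hδd.mono inter_subset_left).fun_inv fun x (hx : x ∈ N) ↦ hx.2)
  · exact ((((hh₁ 0).mul (hg 1)).sub ((hh₁ 1).mul (hg 0))).mono inter_subset_left).mul
      ((hδd.mono inter_subset_left).fun_inv fun x (hx : x ∈ N) ↦ hx.2)
  · -- Cramer: `ℓ₁' δ = h₂₁ t₁ - h₁₁ t₂`, `ℓ₂' δ = h₁₀ t₂ - h₂₀ t₁`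
    have hxδ : δ x ≠ 0 := hx.2
    have e0 := hfg x hx.1
    have e1 := hth₁ x hx.1
    have e2 := hth₂ x hx.1
    simp only [Fin.sum_univ_two, smul_eq_mul] at e0 e1 e2
    have key : f x * δ x = t₁ x * (h₂ 1 x * g 0 x - h₂ 0 x * g 1 x) +
        t₂ x * (h₁ 0 x * g 1 x - h₁ 1 x * g 0 x) := by
      rw [e0, e1, e2]
      ring
    dsimp only
    rw [← div_eq_mul_inv, ← div_eq_mul_inv, mul_div_assoc', mul_div_assoc', ← add_div, eq_div_iff hxδ, key]

/-- **Division by a transversal pair on a convex domain of a surface.** Let `dim E = 2`, `Ω` convex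
open, `t₁, t₂, f` holomorphic on `Ω`, `dt₁ ≠ 0` on `Ω ∩ {t₁ = 0}`, `(dt₁, dt₂)` onto `ℂ²` on
`Ω ∩ {t₁ = t₂ = 0}`, and `f = 0` on `Ω ∩ {t₁ = t₂ = 0}`. Then `f = t₁ g₁ + t₂ g₂` on `Ω` with
`g₁, g₂` holomorphic on `Ω` (local pairs corrected by a solution of the additive Cousin problem for
the Koszul cocycle of their differences). [cite: SerreGAGA1956, n°16 Lemme 8 (proof)] [cite: Chirka1989, §2.8] -/
theorem exists_eq_add_mul_of_eqOn_zero_of_finrank_eq_two (hE : Module.finrank ℂ E = 2) {Ω : Set E}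
    (hΩo : IsOpen Ω) (hΩc : Convex ℝ Ω) {t₁ t₂ f : E → ℂ} (ht₁ : DifferentiableOn ℂ t₁ Ω)
    (ht₂ : DifferentiableOn ℂ t₂ Ω) (hf : DifferentiableOn ℂ f Ω)
    (hd₁ : ∀ x ∈ Ω, t₁ x = 0 → fderiv ℂ t₁ x ≠ 0)
    (hsurj : ∀ x ∈ Ω, t₁ x = 0 → t₂ x = 0 →
      Function.Surjective (ContinuousLinearMap.pi ![fderiv ℂ t₁ x, fderiv ℂ t₂ x]))
    (hf0 : ∀ x ∈ Ω, t₁ x = 0 → t₂ x = 0 → f x = 0) :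
    ∃ g₁ g₂ : E → ℂ, DifferentiableOn ℂ g₁ Ω ∧ DifferentiableOn ℂ g₂ Ω ∧
      ∀ x ∈ Ω, f x = t₁ x * g₁ x + t₂ x * g₂ x := by
  classical
  have hind : ∀ x ∈ Ω, t₁ x = 0 → t₂ x = 0 → ∀ c : ℂ, fderiv ℂ t₂ x ≠ c • fderiv ℂ t₁ x :=
    fun x hx h1 h2 c hc ↦ not_surjective_pi_of_eq_smul hc (hsurj x hx h1 h2)
  -- the index type: points of `Z`, plus two indices for `Ω ∖ {t₁ = 0}` and `Ω ∖ {t₂ = 0}`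
  set Zpt := {y : E // y ∈ Ω ∧ t₁ y = 0 ∧ t₂ y = 0} with hZpt
  choose N hNo hyN hNΩ G₁ G₂ hG₁ hG₂ hfG using fun y : Zpt ↦
    exists_nhds_eq_add_mul_of_finrank_eq_two hE hΩo ht₁ ht₂ hf y.2.1 y.2.2.1 y.2.2.2
      (hf0 y.1 y.2.1 y.2.2.1 y.2.2.2) (hsurj y.1 y.2.1 y.2.2.1 y.2.2.2)
  set Ω₁ : Set E := Ω ∩ t₁ ⁻¹' {0}ᶜ with hΩ₁
  set Ω₂ : Set E := Ω ∩ t₂ ⁻¹' {0}ᶜ with hΩ₂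
  have hΩ₁o : IsOpen Ω₁ := ht₁.continuousOn.isOpen_inter_preimage hΩo isOpen_compl_singleton
  have hΩ₂o : IsOpen Ω₂ := ht₂.continuousOn.isOpen_inter_preimage hΩo isOpen_compl_singleton
  set U : Zpt ⊕ Fin 2 → Set E := fun k ↦ Sum.elim N ![Ω₁, Ω₂] k with hU
  set A₁ : Zpt ⊕ Fin 2 → E → ℂ := fun k ↦ Sum.elim G₁ ![fun x ↦ f x / t₁ x, fun _ ↦ 0] k with hA₁
  set A₂ : Zpt ⊕ Fin 2 → E → ℂ := fun k ↦ Sum.elim G₂ ![fun _ ↦ 0, fun x ↦ f x / t₂ x] k with hA₂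
  have hUo : ∀ k, IsOpen (U k) := by
    rintro (y | i)
    · exact hNo y
    · fin_cases i
      · exact hΩ₁o
      · exact hΩ₂o
  have hUΩ : ∀ k, U k ⊆ Ω := by
    rintro (y | i)
    · exact hNΩ y
    · fin_cases i <;> exact inter_subset_left
  have hA₁d : ∀ k, DifferentiableOn ℂ (A₁ k) (U k) := by
    rintro (y | i)
    · exact hG₁ y
    · fin_cases i
      · exact (hf.mono inter_subset_left).mul
          ((ht₁.mono inter_subset_left).fun_inv fun x (hx : x ∈ Ω₁) ↦ hx.2) |>.congr
            fun x _ ↦ div_eq_mul_inv _ _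
      · exact differentiableOn_const 0
  have hA₂d : ∀ k, DifferentiableOn ℂ (A₂ k) (U k) := by
    rintro (y | i)
    · exact hG₂ y
    · fin_cases i
      · exact differentiableOn_const 0
      · exact (hf.mono inter_subset_left).mul
          ((ht₂.mono inter_subset_left).fun_inv fun x (hx : x ∈ Ω₂) ↦ hx.2) |>.congr
            fun x _ ↦ div_eq_mul_inv _ _
  have hfA : ∀ k, ∀ x ∈ U k, f x = t₁ x * A₁ k x + t₂ x * A₂ k x := by
    rintro (y | i) x hx
    · exact hfG y x hx
    · fin_cases i
      · have h0 : t₁ x ≠ 0 := hx.2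
        change f x = t₁ x * (f x / t₁ x) + t₂ x * 0
        rw [mul_div_cancel₀ _ h0, mul_zero, add_zero]
      · have h0 : t₂ x ≠ 0 := hx.2
        change f x = t₁ x * 0 + t₂ x * (f x / t₂ x)
        rw [mul_div_cancel₀ _ h0, mul_zero, zero_add]
  have hcov : ∀ x ∈ Ω, ∃ k, x ∈ U k := fun x hx ↦ by
    by_cases h1 : t₁ x = 0
    · by_cases h2 : t₂ x = 0
      · exact ⟨Sum.inl ⟨x, hx, h1, h2⟩, hyN ⟨x, hx, h1, h2⟩⟩
      · exact ⟨Sum.inr 1, hx, h2⟩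
    · exact ⟨Sum.inr 0, hx, h1⟩
  -- on the overlaps the pairs differ by Koszul boundaries `(t₂ c, -t₁ c)`
  have hdiv : ∀ k l, ∃ c : E → ℂ, DifferentiableOn ℂ c (U k ∩ U l) ∧
      (∀ x ∈ U k ∩ U l, A₂ k x - A₂ l x = -(t₁ x * c x)) ∧
      ∀ x ∈ U k ∩ U l, A₁ k x - A₁ l x = t₂ x * c x := fun k l ↦ by
    have hO : IsOpen (U k ∩ U l) := (hUo k).inter (hUo l)
    have hsub : U k ∩ U l ⊆ Ω := inter_subset_left.trans (hUΩ k)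
    have hαd : DifferentiableOn ℂ (fun x ↦ A₁ k x - A₁ l x) (U k ∩ U l) :=
      ((hA₁d k).mono inter_subset_left).sub ((hA₁d l).mono inter_subset_right)
    have hβd : DifferentiableOn ℂ (fun x ↦ -(A₂ k x - A₂ l x)) (U k ∩ U l) :=
      (((hA₂d k).mono inter_subset_left).sub ((hA₂d l).mono inter_subset_right)).neg
    -- `t₂ (-β) = t₁ α`
    have hrel : ∀ x ∈ U k ∩ U l, t₂ x • (-(A₂ k x - A₂ l x)) = t₁ x • (A₁ k x - A₁ l x) :=
      fun x hx ↦ by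
      have h1 := hfA k x hx.1
      have h2 := hfA l x hx.2
      simp only [smul_eq_mul]
      linear_combination h1 - h2
    obtain ⟨c, hc, hβc⟩ := SCV.exists_eq_smul_of_mul_eq_mul hO (ht₁.mono hsub) (ht₂.mono hsub) hβd
      (fun x hx ↦ hd₁ x (hsub hx)) (fun x hx ↦ hind x (hsub hx)) hrel
    refine ⟨c, hc, fun x hx ↦ ?_, ?_⟩
    · have := hβc x hx
      rw [smul_eq_mul] at this
      linear_combination -this
    · -- `t₁ α = t₁ (t₂ c)`, cancel `t₁`
      refine SCV.eqOn_of_smul_eq_smul (g₁ := fun x ↦ A₁ k x - A₁ l x) (g₂ := fun x ↦ t₂ x * c x) hO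
        (ht₁.mono hsub) (fun x hx ↦ hd₁ x (hsub hx)) hαd.continuousOn
        (((ht₂.mono hsub)).mul hc).continuousOn fun x hx ↦ ?_
      have h1 := hrel x hx
      have h2 := hβc x hx
      simp only [smul_eq_mul] at h1 h2 ⊢
      rw [h2] at h1
      linear_combination -h1
  choose c hcd hcβ hcα using hdiv
  -- the `c` form a cocycle (cancel `t₁`)
  have hcyc : ∀ k l m, ∀ x ∈ U k ∩ U l ∩ U m, c k l x + c l m x = c k m x := by
    intro k l m
    have hO : IsOpen (U k ∩ U l ∩ U m) := ((hUo k).inter (hUo l)).inter (hUo m)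
    have hsub : U k ∩ U l ∩ U m ⊆ Ω := (inter_subset_left.trans inter_subset_left).trans (hUΩ k)
    refine SCV.eqOn_of_smul_eq_smul (g₁ := fun x ↦ c k l x + c l m x) (g₂ := c k m) hO
      (ht₁.mono hsub) (fun x hx ↦ hd₁ x (hsub hx)) ?_ ?_ fun x hx ↦ ?_
    · exact (((hcd k l).mono fun x hx ↦ ⟨hx.1.1, hx.1.2⟩).add
        ((hcd l m).mono fun x hx ↦ ⟨hx.1.2, hx.2⟩)).continuousOn
    · exact ((hcd k m).mono fun x hx ↦ ⟨hx.1.1, hx.2⟩).continuousOn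
    · simp only [smul_eq_mul]
      have h1 := hcβ k l x ⟨hx.1.1, hx.1.2⟩
      have h2 := hcβ l m x ⟨hx.1.2, hx.2⟩
      have h3 := hcβ k m x ⟨hx.1.1, hx.2⟩
      linear_combination h1 + h2 - h3
  -- Cousin I on the convex `Ω`
  obtain ⟨r, hr, hcr⟩ := exists_holomorphic_cochain_of_cocycle_of_convex hΩo hΩc U hUo hUΩ hcov c
    hcd hcyc
  -- the corrected pairs glue
  have hglue₁ : ∀ k l, ∀ x ∈ U k ∩ U l,
      A₁ k x - t₂ x * r k x = A₁ l x - t₂ x * r l x := fun k l x hx ↦ by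
    have h1 := hcα k l x hx
    have h2 := hcr k l x hx
    rw [h2] at h1
    linear_combination h1
  have hglue₂ : ∀ k l, ∀ x ∈ U k ∩ U l,
      A₂ k x + t₁ x * r k x = A₂ l x + t₁ x * r l x := fun k l x hx ↦ by
    have h1 := hcβ k l x hx
    have h2 := hcr k l x hx
    rw [h2] at h1
    linear_combination h1
  set kx : E → Zpt ⊕ Fin 2 := fun x ↦ if hx : x ∈ Ω then Classical.choose (hcov x hx) else Sum.inr 0
    with hkx
  have hkx_mem : ∀ x ∈ Ω, x ∈ U (kx x) := fun x hx ↦ by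
    simp only [hkx, dif_pos hx]
    exact Classical.choose_spec (hcov x hx)
  have hloc : ∀ {B : Zpt ⊕ Fin 2 → E → ℂ}, (∀ k, DifferentiableOn ℂ (B k) (U k)) →
      (∀ k l, ∀ x ∈ U k ∩ U l, B k x = B l x) → DifferentiableOn ℂ (fun x ↦ B (kx x) x) Ω := by
    intro B hBd hBg x hx
    set k := kx x with hk
    have hxk : x ∈ U k := hkx_mem x hx
    have hev : (fun y ↦ B (kx y) y) =ᶠ[𝓝 x] fun y ↦ B k y := by
      filter_upwards [(hUo k).mem_nhds hxk] with y hy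
      exact hBg (kx y) k y ⟨hkx_mem y (hUΩ k hy), hy⟩
    exact (((hBd k).differentiableAt ((hUo k).mem_nhds hxk)).congr_of_eventuallyEq hev).differentiableWithinAt
  refine ⟨fun x ↦ A₁ (kx x) x - t₂ x * r (kx x) x, fun x ↦ A₂ (kx x) x + t₁ x * r (kx x) x,
    hloc (B := fun k x ↦ A₁ k x - t₂ x * r k x) (fun k ↦ (hA₁d k).sub (((ht₂.mono (hUΩ k))).mul (hr k)))
      hglue₁,
    hloc (B := fun k x ↦ A₂ k x + t₁ x * r k x) (fun k ↦ (hA₂d k).add (((ht₁.mono (hUΩ k))).mul (hr k)))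
      hglue₂, fun x hx ↦ ?_⟩
  have h1 := hfA (kx x) x (hkx_mem x hx)
  linear_combination h1

end Flat

/-! ### On a chart set of a complex surface -/

variable {E : Type*} [NormedAddCommGroup E] [NormedSpace ℂ E] [FiniteDimensional ℂ E]
  {M : Type*} [TopologicalSpace M] [ChartedSpace E M] [IsManifold 𝓘(ℂ, E) ω M]

/-- **Division by a transversal pair on a chart set of a complex surface**: on
`W = chartSet 𝓘(ℝ, E) x₀ C` (`C` convex open in the chart target, `dim E = 2`), for `t₁, t₂, f`
holomorphic on `W` with `dt₁ ≠ 0` on `W ∩ {t₁ = 0}`, `(dt₁, dt₂)` onto `ℂ²` and `f = 0` on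
`W ∩ {t₁ = t₂ = 0}`: `f = t₁ g₁ + t₂ g₂` on `W` with `g₁, g₂` holomorphic on `W`
(`exists_eq_add_mul_of_eqOn_zero_of_finrank_eq_two` read in the chart at `x₀`).
[cite: SerreGAGA1956, n°16 Lemme 8 (proof)] [cite: Chirka1989, §2.8] -/
theorem exists_mdifferentiableOn_eq_add_mul_chartSet (hE : Module.finrank ℂ E = 2) (x₀ : M) {C : Set E}
    (hCo : IsOpen C) (hCc : Convex ℝ C) (hCT : C ⊆ (extChartAt 𝓘(ℝ, E) x₀).target) {t₁ t₂ f : M → ℂ}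
    (ht₁ : MDifferentiableOn 𝓘(ℂ, E) 𝓘(ℂ, ℂ) t₁ (chartSet 𝓘(ℝ, E) x₀ C))
    (ht₂ : MDifferentiableOn 𝓘(ℂ, E) 𝓘(ℂ, ℂ) t₂ (chartSet 𝓘(ℝ, E) x₀ C))
    (hf : MDifferentiableOn 𝓘(ℂ, E) 𝓘(ℂ, ℂ) f (chartSet 𝓘(ℝ, E) x₀ C))
    (hd₁ : ∀ x ∈ chartSet 𝓘(ℝ, E) x₀ C, t₁ x = 0 → mfderiv 𝓘(ℂ, E) 𝓘(ℂ, ℂ) t₁ x ≠ 0)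
    (hsurj : ∀ x ∈ chartSet 𝓘(ℝ, E) x₀ C, t₁ x = 0 → t₂ x = 0 →
      Function.Surjective (ContinuousLinearMap.pi ![mfderiv 𝓘(ℂ, E) 𝓘(ℂ, ℂ) t₁ x, mfderiv 𝓘(ℂ, E) 𝓘(ℂ, ℂ) t₂ x]))
    (hf0 : ∀ x ∈ chartSet 𝓘(ℝ, E) x₀ C, t₁ x = 0 → t₂ x = 0 → f x = 0) :
    ∃ g₁ g₂ : M → ℂ, MDifferentiableOn 𝓘(ℂ, E) 𝓘(ℂ, ℂ) g₁ (chartSet 𝓘(ℝ, E) x₀ C) ∧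
      MDifferentiableOn 𝓘(ℂ, E) 𝓘(ℂ, ℂ) g₂ (chartSet 𝓘(ℝ, E) x₀ C) ∧
      ∀ x ∈ chartSet 𝓘(ℝ, E) x₀ C, f x = t₁ x * g₁ x + t₂ x * g₂ x := by
  set φ := extChartAt 𝓘(ℂ, E) x₀ with hφ
  set W := chartSet 𝓘(ℝ, E) x₀ C with hW
  have hWo : IsOpen W := isOpen_chartSet 𝓘(ℝ, E) x₀ hCo
  have hWs : W ⊆ φ.source := chartSet_subset_source 𝓘(ℝ, E) x₀ C
  have hφW : ∀ x ∈ W, φ x ∈ C := fun x hx ↦ (mem_chartSet_iff.1 hx).2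
  have hsymm : ∀ y ∈ C, φ.symm y ∈ W := fun y hy ↦ symm_mem_chartSet hCT hy
  have hrd : ∀ {u : M → ℂ}, MDifferentiableOn 𝓘(ℂ, E) 𝓘(ℂ, ℂ) u W → DifferentiableOn ℂ (u ∘ φ.symm) C :=
    fun hu ↦ (differentiableOn_comp_extChartAt_symm_of_mdifferentiableOn hu hWo x₀).mono
      fun y hy ↦ ⟨hCT hy, hsymm y hy⟩
  have hts : ∀ {u : M → ℂ}, MDifferentiableOn 𝓘(ℂ, E) 𝓘(ℂ, ℂ) u W → ∀ y ∈ C,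
      DifferentiableAt ℂ (u ∘ φ.symm) (φ (φ.symm y)) := fun hu y hy ↦ by
    rw [φ.right_inv (hCT hy)]
    exact (hrd hu).differentiableAt (hCo.mem_nhds hy)
  -- `mfderiv u x = fderiv (u ∘ φ.symm) (φ x) ∘ dφ(x)` with `dφ(x)` invertible
  have hmf : ∀ {u : M → ℂ}, MDifferentiableOn 𝓘(ℂ, E) 𝓘(ℂ, ℂ) u W → ∀ y ∈ C,
      mfderiv 𝓘(ℂ, E) 𝓘(ℂ, ℂ) u (φ.symm y) =
        (fderiv ℂ (u ∘ φ.symm) y).comp (mfderiv 𝓘(ℂ, E) 𝓘(ℂ, E) φ (φ.symm y)) := fun hu y hy ↦ by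
    have h := mfderiv_eq_fderiv_comp_symm_comp x₀ (hWs (hsymm y hy)) (hts hu y hy)
    rwa [φ.right_inv (hCT hy)] at h
  have hd₁' : ∀ y ∈ C, (t₁ ∘ φ.symm) y = 0 → fderiv ℂ (t₁ ∘ φ.symm) y ≠ 0 := fun y hy hty h0 ↦ by
    have hx : φ.symm y ∈ W := hsymm y hy
    refine hd₁ _ hx hty ?_
    rw [hmf ht₁ y hy, h0]
    exact ContinuousLinearMap.zero_comp _
  have hsurj' : ∀ y ∈ C, (t₁ ∘ φ.symm) y = 0 → (t₂ ∘ φ.symm) y = 0 →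
      Function.Surjective (ContinuousLinearMap.pi ![fderiv ℂ (t₁ ∘ φ.symm) y, fderiv ℂ (t₂ ∘ φ.symm) y]) :=
    fun y hy h1 h2 w ↦ by
    have hx : φ.symm y ∈ W := hsymm y hy
    obtain ⟨v, hv⟩ := hsurj _ hx h1 h2 w
    refine ⟨mfderiv 𝓘(ℂ, E) 𝓘(ℂ, E) φ (φ.symm y) v, ?_⟩
    rw [← hv]
    ext i
    fin_cases i
    · change fderiv ℂ (t₁ ∘ φ.symm) y (mfderiv 𝓘(ℂ, E) 𝓘(ℂ, E) φ (φ.symm y) v) =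
        mfderiv 𝓘(ℂ, E) 𝓘(ℂ, ℂ) t₁ (φ.symm y) v
      rw [hmf ht₁ y hy]
      rfl
    · change fderiv ℂ (t₂ ∘ φ.symm) y (mfderiv 𝓘(ℂ, E) 𝓘(ℂ, E) φ (φ.symm y) v) =
        mfderiv 𝓘(ℂ, E) 𝓘(ℂ, ℂ) t₂ (φ.symm y) v
      rw [hmf ht₂ y hy]
      rfl
  have hf0' : ∀ y ∈ C, (t₁ ∘ φ.symm) y = 0 → (t₂ ∘ φ.symm) y = 0 → (f ∘ φ.symm) y = 0 :=
    fun y hy h1 h2 ↦ hf0 _ (hsymm y hy) h1 h2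
  obtain ⟨G₁, G₂, hG₁, hG₂, hfG⟩ := exists_eq_add_mul_of_eqOn_zero_of_finrank_eq_two hE hCo hCc
    (hrd ht₁) (hrd ht₂) (hrd hf) hd₁' hsurj' hf0'
  have hback : ∀ {G : E → ℂ}, DifferentiableOn ℂ G C →
      MDifferentiableOn 𝓘(ℂ, E) 𝓘(ℂ, ℂ) (fun x ↦ G (φ x)) W := fun {G} hG x hx ↦ by
    have hxs : x ∈ (chartAt E x₀).source := by
      rw [← extChartAt_source 𝓘(ℂ, E)]; exact hWs hx
    have h1 : MDifferentiableAt 𝓘(ℂ, E) 𝓘(ℂ, ℂ) G (φ x) :=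
      mdifferentiableAt_iff_differentiableAt.2 (hG.differentiableAt (hCo.mem_nhds (hφW x hx)))
    exact (h1.comp x (mdifferentiableAt_extChartAt hxs)).mdifferentiableWithinAt
  refine ⟨fun x ↦ G₁ (φ x), fun x ↦ G₂ (φ x), hback hG₁, hback hG₂, fun x hx ↦ ?_⟩
  have h1 := hfG (φ x) (hφW x hx)
  simp only [Function.comp_apply, φ.left_inv (hWs hx)] at h1
  exact h1

end Literature.Geometry.Kaehler

end
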